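import Literature.NumberTheory.LFunctions.CharZeroSum
import Literature.NumberTheory.LFunctions.SmoothedExplicitFormulaCharContour
import Literature.NumberTheory.LFunctions.ExplicitFormulaPsiCharLogDeriv
import HarnessLib

/-!
# The smoothed explicit formula for `L(s, χ)`, II: the exact formula

Topic `Literature/NumberTheory/LFunctions`, sub-namespace `ExplicitPsiChar`. Everything in this
file is PROVED; the two definitions (`charEFRemainder`, `charTrivialZeroFinset`) are glue. This is
the character analogue of the tree's `SmoothedEF.fordK_eq_explicit` (Ford 2002 Lemma 4.5 / Kadiri
2005 Prop. 2.1 for `ζ`), i.e.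

* D. R. Heath-Brown, PLMS 64 (1992), **Lemma 5.1** ((5.6)–(5.7)): for a primitive character `χ`
  mod `q > 1`, an admissible smoothing `f` (`IsSmoothedEFTest f p p' p'' x₀`: continuous, `= p ∈ C²`
  on `[0, x₀]` with `p(x₀) = p'(x₀) = 0`, zero beyond) and `−1/2 < Re s < 3/2` with `L(s, χ) ≠ 0`,
  `K_{f,χ}(s) = Σ Λ(n)χ(n) f(log n) n^{-s}
     = −f(0) (L'/L)(s, χ) − Σ_ρ m(ρ) F₀(s − ρ) − Σ_{τ} m(τ) F₀(s − τ) + J_χ(s)`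
  (`charFordK_eq_explicit`), where `ρ` runs over the non-trivial zeros (absolutely convergent,
  `summable_norm_charZeroTerm`), `τ` over the (at most two, simple) trivial zeros of `L(·, χ)` on
  `[−5/2, 0]` (`charTrivialZeroFinset`: `{0, −2}` for even `χ`, `{−1}` for odd `χ`), and
  `J_χ(s) = (1/2π) ∫_ℝ (−L'/L)(−5/2 + iy, χ) F₀(s + 5/2 − iy) dy` (`charEFRemainder`) is the left-line
  integral. Heath-Brown puts the left line at `Re w = −1/2` and states the remainder as
  `O(L⁻¹ ℒ)` for his scaled `f(L⁻¹·)`; here the line is `Re w = −5/2` (where the tree bounds `L'/L`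
  for all ordinates) and the formula is exact — bounds for `J_χ` are proved separately.

Ingredients: the contour identity `charEF_contour_identity` at the good heights of
`ExplicitPsiChar.exists_goodHeight`, the bounds `exists_norm_logDeriv_LFunction_le_strip/le_left/
farLeft_le` on the horizontal sides and the left line, the prime side
`integral_logDeriv_LFunction_mul_fordLaplace₀` on the right line, and `Σ m(ρ)/(1+γ²) < ∞`
(`summable_zeroOrder_div_one_add_sq`).

## References

* D. R. Heath-Brown, Proc. London Math. Soc. (3) 64 (1992), Lemma 5.1. [cite: HeathBrown1992PLMS, Lemma 5.1]
* K. Ford, *Zero-free regions for the Riemann zeta function* (2002), Lemma 4.5. [cite: Ford2002Millennium, Lemma 4.5]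
-/

noncomputable section

open Complex Real MeasureTheory Set Filter Topology ArithmeticFunction
open scoped LSeries.notation

namespace Literature.NumberTheory.LFunctions

namespace ExplicitPsiChar

variable {q : ℕ} [NeZero q] {χ : DirichletCharacter ℂ q} {f p p' p'' : ℝ → ℝ} {x₀ : ℝ}

/-! ## The remainder and the trivial zeros -/

/-- The left-line integral `J_χ(s) = (1/2π) ∫_ℝ (−L'/L)(−5/2 + iy, χ) F₀(s + 5/2 − iy) dy`.
[cite: HeathBrown1992PLMS, Lemma 5.1 (proof)] -/
def charEFRemainder (χ : DirichletCharacter ℂ q) (f : ℝ → ℝ) (s : ℂ) : ℂ :=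
  (1 / (2 * π) : ℂ) * ∫ y : ℝ, charEFIntegrand χ f s (((-(5 / 2) : ℝ) : ℂ) + y * I)

/-- The zeros of `L(·, χ)` (`χ ≠ χ₀`) on the real segment `[−5/2, 0]`, as a `Finset` (for a primitive
`χ` mod `q > 1`: `{0, −2}` if `χ` is even, `{−1}` if `χ` is odd). [cite: MontgomeryVaughan2007, Corollary 10.8] -/
def charTrivialZeroFinset (hχ : χ ≠ 1) : Finset ℂ :=
  (finite_inter_zeros_of_isCompact hχ
    ((isCompact_Icc (a := (-(5 / 2) : ℝ)) (b := 0)).reProdIm (isCompact_Icc (a := (0 : ℝ)) (b := 0)))).toFinset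

/-- Membership in `charTrivialZeroFinset`. [folklore] -/
theorem mem_charTrivialZeroFinset {hχ : χ ≠ 1} {τ : ℂ} :
    τ ∈ charTrivialZeroFinset hχ ↔ χ.LFunction τ = 0 ∧ -(5 / 2) ≤ τ.re ∧ τ.re ≤ 0 ∧ τ.im = 0 := by
  rw [charTrivialZeroFinset, Set.Finite.mem_toFinset, mem_inter_iff, Complex.mem_reProdIm, mem_Icc,
    mem_Icc, mem_preimage, mem_singleton_iff]
  constructor
  · rintro ⟨⟨⟨h1, h2⟩, h3, h4⟩, h0⟩
    exact ⟨h0, h1, h2, le_antisymm h4 h3⟩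
  · rintro ⟨h0, h1, h2, h3⟩
    exact ⟨⟨⟨h1, h2⟩, h3.ge, h3.le⟩, h0⟩

/-- **The zeros in the rectangle split**: for a primitive `χ` mod `q > 1` and `T ≥ 0`, the zeros of
`L(·, χ)` in `[−5/2, 3/2] × [−T, T]` are the non-trivial ones with `|Im ρ| ≤ T` together with the
trivial ones on `[−5/2, 0]`, disjointly. [cite: MontgomeryVaughan2007, Corollary 10.8] -/
theorem rect_zeros_eq_union (hprim : χ.IsPrimitive) (hq : 1 < q) {T : ℝ} (hT : 0 ≤ T) :
    (finite_inter_zeros_of_isCompact (ne_one_of_isPrimitive hprim hq)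
        ((isCompact_Icc (a := -(5 / 2 : ℝ)) (b := 3 / 2)).reProdIm
          (isCompact_Icc (a := -T) (b := T)))).toFinset =
      (lfunctionZeroBox_finite (ne_one_of_isPrimitive hprim hq) T).toFinset ∪
        charTrivialZeroFinset (ne_one_of_isPrimitive hprim hq) := by
  have hχ : χ ≠ 1 := ne_one_of_isPrimitive hprim hq
  ext ρ
  rw [Finset.mem_union, Set.Finite.mem_toFinset, Set.Finite.mem_toFinset, mem_charTrivialZeroFinset,
    mem_lfunctionZeroBox, mem_inter_iff, Complex.mem_reProdIm, mem_Icc, mem_Icc, mem_preimage,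
    mem_singleton_iff]
  constructor
  · rintro ⟨⟨⟨h1, h2⟩, h3, h4⟩, h0⟩
    rcases lt_or_ge 0 ρ.re with hre | hre
    · refine Or.inl ⟨h0, hre, ?_, abs_le.2 ⟨h3, h4⟩⟩
      by_contra h
      exact DirichletCharacter.LFunction_ne_zero_of_one_le_re χ (Or.inl hχ) (not_lt.1 h) h0
    · have hγ : DirichletCharacter.gammaFactor χ ρ = 0 :=
        (LFunction_eq_zero_iff_gammaFactor hprim hχ hre).1 h0
      exact Or.inr ⟨h0, h1, hre, (im_eq_zero_of_gammaFactor_eq_zero χ hγ).1⟩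
  · rintro (⟨h0, h1, h2, h3⟩ | ⟨h0, h1, h2, h3⟩)
    · exact ⟨⟨⟨by linarith, by linarith⟩, (abs_le.1 h3).1, (abs_le.1 h3).2⟩, h0⟩
    · exact ⟨⟨⟨h1, by linarith⟩, by rw [h3]; linarith, by rw [h3]; linarith⟩, h0⟩

/-- The two parts are disjoint. [folklore] -/
theorem disjoint_box_trivial (hχ : χ ≠ 1) (T : ℝ) :
    Disjoint (lfunctionZeroBox_finite hχ T).toFinset (charTrivialZeroFinset hχ) := by
  rw [Finset.disjoint_left]
  intro ρ h1 h2
  rw [Set.Finite.mem_toFinset, mem_lfunctionZeroBox] at h1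
  rw [mem_charTrivialZeroFinset] at h2
  linarith [h1.2.1, h2.2.2.1]

/-! ## The zero sum converges absolutely -/

/-- The non-trivial zeros stay at a positive distance from a point `s` with `L(s, χ) ≠ 0`. [folklore] -/
theorem exists_dist_charZeros_ge (hχ : χ ≠ 1) {s : ℂ} (hLs : χ.LFunction s ≠ 0) :
    ∃ d : ℝ, 0 < d ∧ d ≤ 1 ∧ ∀ ρ ∈ charNontrivialZeros χ, d ≤ ‖s - ρ‖ := by
  classical
  have hfin := lfunctionZeroBox_finite hχ (|s.im| + 1)
  set A : Finset ℝ := insert 1 (hfin.toFinset.image fun ρ ↦ ‖s - ρ‖) with hA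
  have hne : A.Nonempty := ⟨1, Finset.mem_insert_self _ _⟩
  have hpos : ∀ a ∈ A, 0 < a := by
    intro a ha
    rw [hA, Finset.mem_insert, Finset.mem_image] at ha
    rcases ha with rfl | ⟨ρ, hρ, rfl⟩
    · exact one_pos
    · rw [Set.Finite.mem_toFinset] at hρ
      exact norm_pos_iff.2 (sub_ne_zero.2 fun h ↦ hLs (h ▸ hρ.1))
  refine ⟨A.min' hne, hpos _ (Finset.min'_mem _ _), Finset.min'_le _ _ (Finset.mem_insert_self _ _),
    fun ρ hρ ↦ ?_⟩
  by_cases hγ : |ρ.im| ≤ |s.im| + 1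
  · refine Finset.min'_le _ _ ?_
    rw [hA, Finset.mem_insert, Finset.mem_image]
    refine Or.inr ⟨ρ, ?_, rfl⟩
    rw [Set.Finite.mem_toFinset, lfunctionZeroBox_eq_inter]
    exact ⟨hρ, hγ⟩
  · push Not at hγ
    have h1 : (1 : ℝ) ≤ ‖s - ρ‖ := by
      have := Complex.abs_im_le_norm (s - ρ)
      rw [sub_im] at this
      have h2 : |ρ.im| - |s.im| ≤ |s.im - ρ.im| := by
        have := abs_sub_abs_le_abs_sub ρ.im s.im
        rwa [abs_sub_comm] at this
      linarith
    exact (Finset.min'_le _ _ (Finset.mem_insert_self _ _)).trans h1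

/-- **Absolute convergence of the zero sum** `Σ_ρ m(ρ) F₀(s − ρ)` for a primitive `χ` mod `q > 1`,
an admissible `f`, `Re s > −1` and `L(s, χ) ≠ 0`: `|F₀(s − ρ)| ≤ D/|s − ρ|²` and `Σ m(ρ)/(1+γ²) < ∞`.
[cite: HeathBrown1992PLMS, Lemma 5.1] -/
theorem summable_norm_charZeroTerm (hprim : χ.IsPrimitive) (hq : 1 < q)
    (h : IsSmoothedEFTest f p p' p'' x₀) {s : ℂ} (hσ₁ : -1 < s.re) (hLs : χ.LFunction s ≠ 0) :
    Summable fun ρ : charNontrivialZeros χ ↦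
      ‖(DirichletDisc.zeroOrder χ (ρ : ℂ) : ℂ) * fordLaplace₀ f (s - ρ)‖ := by
  have hχ : χ ≠ 1 := ne_one_of_isPrimitive hprim hq
  obtain ⟨d, hd0, hd1, hd⟩ := exists_dist_charZeros_ge hχ hLs
  set D := SmoothedEF.decayConst p' p'' x₀ with hD
  have hD0 : 0 ≤ D := SmoothedEF.decayConst_nonneg h.x₀_nonneg
  set C : ℝ := (1 + 2 * s.im ^ 2) / d ^ 2 + 2 with hC
  refine summable_of_norm_le_mul_zeroOrder_div hprim hq (B := D * C) fun ρ ↦ ?_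
  have hm : (0 : ℝ) ≤ DirichletDisc.zeroOrder χ (ρ : ℂ) := Nat.cast_nonneg _
  have hρ := ρ.2
  have hre0 := hρ.2.1
  have hre1 := hρ.2.2
  have hdρ := hd _ hρ
  have hne : s - (ρ : ℂ) ≠ 0 := norm_pos_iff.1 (hd0.trans_le hdρ)
  have hF := SmoothedEF.norm_fordLaplace₀_le h hne (by rw [sub_re]; linarith)
  rw [norm_mul, Complex.norm_natCast]
  have hn2 : (s.im - (ρ : ℂ).im) ^ 2 ≤ ‖s - ρ‖ ^ 2 := by
    have := Complex.abs_im_le_norm (s - ρ)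
    rw [sub_im] at this
    nlinarith [abs_nonneg (s.im - (ρ : ℂ).im), sq_abs (s.im - (ρ : ℂ).im)]
  have hd2 : d ^ 2 ≤ ‖s - ρ‖ ^ 2 := by nlinarith [norm_nonneg (s - (ρ : ℂ))]
  have hkey : 1 + (ρ : ℂ).im ^ 2 ≤ C * ‖s - ρ‖ ^ 2 := by
    have h1 : (ρ : ℂ).im ^ 2 ≤ 2 * (s.im - (ρ : ℂ).im) ^ 2 + 2 * s.im ^ 2 := by
      nlinarith [sq_nonneg (s.im - 2 * (ρ : ℂ).im), sq_nonneg ((ρ : ℂ).im - 2 * s.im),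
        sq_nonneg (2 * s.im - (ρ : ℂ).im)]
    have h2 : 1 + 2 * s.im ^ 2 ≤ (1 + 2 * s.im ^ 2) / d ^ 2 * ‖s - ρ‖ ^ 2 := by
      rw [div_mul_eq_mul_div, le_div_iff₀ (by positivity)]
      exact mul_le_mul_of_nonneg_left hd2 (by positivity)
    calc 1 + (ρ : ℂ).im ^ 2 ≤ (1 + 2 * s.im ^ 2) + 2 * (s.im - (ρ : ℂ).im) ^ 2 := by linarith
      _ ≤ (1 + 2 * s.im ^ 2) / d ^ 2 * ‖s - ρ‖ ^ 2 + 2 * ‖s - ρ‖ ^ 2 := by linarith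
      _ = C * ‖s - ρ‖ ^ 2 := by rw [hC]; ring
  have hpos : 0 < ‖s - (ρ : ℂ)‖ ^ 2 := by positivity
  calc (DirichletDisc.zeroOrder χ (ρ : ℂ) : ℝ) * ‖fordLaplace₀ f (s - ρ)‖
      ≤ (DirichletDisc.zeroOrder χ (ρ : ℂ) : ℝ) * (D / ‖s - ρ‖ ^ 2) := mul_le_mul_of_nonneg_left hF hm
    _ ≤ (DirichletDisc.zeroOrder χ (ρ : ℂ) : ℝ) * (D * C / (1 + (ρ : ℂ).im ^ 2)) := by
        refine mul_le_mul_of_nonneg_left ?_ hm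
        rw [div_le_div_iff₀ hpos (by positivity)]
        calc D * (1 + (ρ : ℂ).im ^ 2) ≤ D * (C * ‖s - ρ‖ ^ 2) := mul_le_mul_of_nonneg_left hkey hD0
          _ = D * C * ‖s - ρ‖ ^ 2 := by ring
    _ = D * C * ((DirichletDisc.zeroOrder χ (ρ : ℂ) : ℝ) / (1 + (ρ : ℂ).im ^ 2)) := by ring

/-! ## The left line `Re w = −5/2` -/

/-- **`L'/L` on the left line, all ordinates**: there is an absolute `A` with
`L(−5/2 + iy, χ) ≠ 0` and `‖L'/L(−5/2 + iy, χ)‖ ≤ A + log q + 2 log(1 + |y|)` for every primitive `χ`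
mod `q > 1` and every real `y` (`…le_left` for `|y| ≥ 2`, `…farLeft_le` with `K = 1` for `|y| < 2`).
[cite: MontgomeryVaughan2007, Lemma 12.9] -/
theorem exists_norm_logDeriv_LFunction_leftLine_le :
    ∃ A : ℝ, 0 < A ∧ ∀ (q : ℕ) [NeZero q] (χ : DirichletCharacter ℂ q), χ.IsPrimitive → 1 < q →
      ∀ y : ℝ, χ.LFunction ((((-(5 / 2) : ℝ)) : ℂ) + y * I) ≠ 0 ∧
        ‖deriv χ.LFunction ((((-(5 / 2) : ℝ)) : ℂ) + y * I) /
            χ.LFunction ((((-(5 / 2) : ℝ)) : ℂ) + y * I)‖ ≤ A + Real.log q + 2 * Real.log (1 + |y|) := by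
  obtain ⟨A₁, hA₁0, hA₁⟩ := exists_norm_logDeriv_LFunction_le_left
  obtain ⟨A₂, hA₂0, hA₂⟩ := exists_norm_logDeriv_LFunction_farLeft_le
  refine ⟨max (A₁ + 25 / 2 + Real.log 4) (A₂ + 10), lt_max_of_lt_left (by positivity), ?_⟩
  intro q _ χ hprim hq y
  have hlog0 : 0 ≤ Real.log (1 + |y|) := Real.log_nonneg (by linarith [abs_nonneg y])
  by_cases hy : 2 ≤ |y|
  · obtain ⟨hne, hb⟩ := hA₁ q χ hprim hq (-(5 / 2)) y (by norm_num) hy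
    refine ⟨hne, ?_⟩
    rw [← logDeriv_apply]
    refine hb.trans ?_
    have h4 : Real.log (|y| + 4) ≤ Real.log 4 + Real.log (1 + |y|) := by
      rw [← Real.log_mul (by norm_num) (by positivity)]
      exact Real.log_le_log (by positivity) (by nlinarith [abs_nonneg y])
    have : A₁ + 25 / 2 + Real.log 4 ≤ max (A₁ + 25 / 2 + Real.log 4) (A₂ + 10) := le_max_left _ _
    norm_num at hb ⊢
    linarith
  · push Not at hy
    obtain ⟨hne, hb⟩ := hA₂ q χ hprim hq 1 le_rfl y
    have hcast : (((-(2 * ((1 : ℕ) : ℝ)) - 1 / 2 : ℝ)) : ℂ) = (((-(5 / 2) : ℝ)) : ℂ) := by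
      push_cast; ring
    rw [hcast] at hne hb
    refine ⟨hne, ?_⟩
    rw [← logDeriv_apply]
    refine hb.trans ?_
    have : A₂ + 10 ≤ max (A₁ + 25 / 2 + Real.log 4) (A₂ + 10) := le_max_right _ _
    push_cast at *
    linarith [abs_nonneg y]

/-- The integrand `y ↦ G(−5/2 + iy)` is continuous (primitive `χ` mod `q > 1`, `Re s > −5/2`). [folklore] -/
theorem continuous_charIntegrand_left (hprim : χ.IsPrimitive) (hq : 1 < q) (h : IsSmoothedEFTest f p p' p'' x₀)
    {s : ℂ} (hσ₁ : -(5 / 2) < s.re) :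
    Continuous fun y : ℝ ↦ charEFIntegrand χ f s (((-(5 / 2) : ℝ) : ℂ) + y * I) := by
  have hχ : χ ≠ 1 := ne_one_of_isPrimitive hprim hq
  obtain ⟨A, -, hA⟩ := exists_norm_logDeriv_LFunction_leftLine_le
  set Lv : ℝ → ℂ := fun y : ℝ ↦ (((-(5 / 2) : ℝ) : ℂ) + y * I) with hLv
  have hline : Continuous Lv := by rw [hLv]; fun_prop
  have hcomp : (fun y : ℝ ↦ charEFIntegrand χ f s (((-(5 / 2) : ℝ) : ℂ) + y * I)) =
      (fun w ↦ -(deriv χ.LFunction w / χ.LFunction w) * fordLaplace₀ f (s - w)) ∘ Lv := rfl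
  rw [hcomp]
  refine continuous_iff_continuousAt.2 fun y ↦ ContinuousAt.comp (x := y) ?_ hline.continuousAt
  have hL : χ.LFunction (Lv y) ≠ 0 := (hA q χ hprim hq y).1
  have hsw : s - Lv y ≠ 0 := by
    intro h0
    have := congrArg Complex.re h0
    simp [hLv] at this
    linarith
  have han : AnalyticAt ℂ χ.LFunction (Lv y) :=
    (DirichletCharacter.differentiable_LFunction hχ).analyticAt _
  exact ((han.deriv.continuousAt.div han.continuousAt hL).neg).mul
    (((differentiableAt_fordLaplace₀ h.cont h.x₀_nonneg h.eq_zero hsw).continuousAt).comp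
      (continuousAt_const.sub continuousAt_id))

/-- **The left-line integrand is integrable on `ℝ`** (`Re s > −1/2`):
`|L'/L(−5/2 + iy)| ≤ A + log q + 2 log(1 + |y|)` against `|F₀| ≤ D/((σ + 5/2)² + (t − y)²)`. [folklore] -/
theorem integrable_charIntegrand_left (hprim : χ.IsPrimitive) (hq : 1 < q)
    (h : IsSmoothedEFTest f p p' p'' x₀) {s : ℂ} (hσ₁ : -(1 / 2) < s.re) :
    Integrable fun y : ℝ ↦ charEFIntegrand χ f s (((-(5 / 2) : ℝ) : ℂ) + y * I) := by
  obtain ⟨A, hA0, hA⟩ := exists_norm_logDeriv_LFunction_leftLine_le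
  set D := SmoothedEF.decayConst p' p'' x₀ with hD
  have hD0 : 0 ≤ D := SmoothedEF.decayConst_nonneg h.x₀_nonneg
  have hq0 : 0 ≤ Real.log q := Real.log_natCast_nonneg q
  set a : ℝ := s.re + 5 / 2 with ha
  have ha0 : 0 < a := by rw [ha]; linarith
  refine (((SmoothedEF.integrable_left_majorant' (A := A + Real.log q) (by positivity) ha0
    (t := s.im)).const_mul D)).mono'
    (continuous_charIntegrand_left hprim hq h (by linarith)).aestronglyMeasurable (ae_of_all _ fun y ↦ ?_)
  set w : ℂ := ((-(5 / 2) : ℝ) : ℂ) + y * I with hw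
  have hsw_re : (s - w).re = a := by simp [hw, ha]
  have hsw_im : (s - w).im = s.im - y := by simp [hw]
  have hsw : s - w ≠ 0 := fun h0 ↦ by
    have := congrArg Complex.re h0
    rw [hsw_re, Complex.zero_re] at this
    linarith
  have hnorm : ‖s - w‖ ^ 2 = a ^ 2 + (s.im - y) ^ 2 := by
    rw [Complex.sq_norm, Complex.normSq_apply, hsw_re, hsw_im]; ring
  have hF : ‖fordLaplace₀ f (s - w)‖ ≤ D / (a ^ 2 + (s.im - y) ^ 2) := by
    rw [← hnorm]
    exact SmoothedEF.norm_fordLaplace₀_le h hsw (by rw [hsw_re]; linarith)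
  rw [charEFIntegrand, norm_mul, norm_neg]
  obtain ⟨-, hb⟩ := hA q χ hprim hq y
  have hC1 : 0 ≤ A + Real.log q + 2 * Real.log (1 + |y|) :=
    add_nonneg (by positivity) (mul_nonneg two_pos.le (Real.log_nonneg (by linarith [abs_nonneg y])))
  calc ‖deriv χ.LFunction w / χ.LFunction w‖ * ‖fordLaplace₀ f (s - w)‖
      ≤ (A + Real.log q + 2 * Real.log (1 + |y|)) * (D / (a ^ 2 + (s.im - y) ^ 2)) :=
        mul_le_mul hb hF (norm_nonneg _) hC1
    _ = D * ((A + Real.log q + 2 * Real.log (1 + |y|)) / (a ^ 2 + (s.im - y) ^ 2)) := by ring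

/-! ## The right line `Re w = 3/2` -/

/-- On the right line the integrand is that of the prime side:
`∫_ℝ G(3/2 + iv) dv = 2π K_{f,χ}(s)` and the integrand is integrable (`Re s < 3/2`). [folklore] -/
theorem integral_charIntegrand_right (h : IsSmoothedEFTest f p p' p'' x₀) {s : ℂ} (hσ₂ : s.re < 3 / 2) :
    Integrable (fun v : ℝ ↦ charEFIntegrand χ f s (((3 / 2 : ℝ) : ℂ) + v * I)) ∧
      ∫ v : ℝ, charEFIntegrand χ f s (((3 / 2 : ℝ) : ℂ) + v * I) = 2 * π * charFordK χ f s := by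
  have hα : (1 : ℝ) < 3 / 2 := by norm_num
  have hint : Integrable fun y : ℝ ↦ fordLaplace₀ f ((s.re - 3 / 2 : ℝ) + y * I) :=
    SmoothedEF.integrable_vertical h (by linarith)
  have heq : (fun v : ℝ ↦ charEFIntegrand χ f s (((3 / 2 : ℝ) : ℂ) + v * I)) = fun v : ℝ ↦
      -(deriv χ.LFunction (((3 / 2 : ℝ) : ℂ) + v * I) / χ.LFunction (((3 / 2 : ℝ) : ℂ) + v * I)) *
        fordLaplace₀ f (s - ((3 / 2 : ℝ) + v * I)) := by
    funext v; rw [charEFIntegrand]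
  have heq2 : (fun v : ℝ ↦ -(deriv χ.LFunction (((3 / 2 : ℝ) : ℂ) + v * I) /
      χ.LFunction (((3 / 2 : ℝ) : ℂ) + v * I)) * fordLaplace₀ f (s - ((3 / 2 : ℝ) + v * I))) =
      fun v : ℝ ↦ L (↗χ * ↗Λ) (((3 / 2 : ℝ) : ℂ) + v * I) * fordLaplace₀ f (s - ((3 / 2 : ℝ) + v * I)) := by
    funext v
    have h1 : 1 < ((((3 / 2 : ℝ)) : ℂ) + v * I).re := by simp; norm_num
    rw [DirichletCharacter.LSeries_twist_vonMangoldt_eq χ h1, neg_div,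
      DirichletCharacter.deriv_LFunction_eq_deriv_LSeries χ h1, DirichletCharacter.LFunction_eq_LSeries χ h1]
  refine ⟨?_, ?_⟩
  · rw [heq, heq2]
    exact integrable_LSeries_twist_mul_fordLaplace₀ χ hα hint
  · rw [heq]
    exact integral_logDeriv_LFunction_mul_fordLaplace₀ χ h.cont h.eq_zero hα hσ₂ hint

/-! ## The horizontal sides -/

/-- **`L'/L` on the horizontal sides**: there is an absolute `C_h > 0` such that for every primitive
`χ` mod `q > 1`, `|t| ≥ 2`, `0 < η ≤ 1` with all non-trivial zeros `η`-separated from the ordinate `t`,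
and every `σ ∈ [−5/2, 3/2]`: `‖L'/L(σ + it, χ)‖ ≤ C_h (log q + log(|t| + 4))/η`
(`…le_strip` on `[−1/2, 3/2]`, `…le_left` on `[−5/2, −1/2]`). [cite: MontgomeryVaughan2007, Lemma 12.8] -/
theorem exists_norm_logDeriv_LFunction_horizontal_le :
    ∃ Ch : ℝ, 0 < Ch ∧ ∀ (q : ℕ) [NeZero q] (χ : DirichletCharacter ℂ q), χ.IsPrimitive → 1 < q →
      ∀ t η : ℝ, 2 ≤ |t| → 0 < η → η ≤ 1 →
        (∀ ρ : ℂ, χ.LFunction ρ = 0 → 0 < ρ.re → ρ.re < 1 → η ≤ |ρ.im - t|) →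
        ∀ σ : ℝ, σ ∈ Icc (-(5 / 2) : ℝ) (3 / 2) →
          ‖deriv χ.LFunction (σ + t * I) / χ.LFunction (σ + t * I)‖ ≤
            Ch * (Real.log q + Real.log (|t| + 4)) / η := by
  obtain ⟨C₁, hC₁0, hC₁⟩ := exists_norm_logDeriv_LFunction_le_strip
  obtain ⟨A₁, hA₁0, hA₁⟩ := exists_norm_logDeriv_LFunction_le_left
  refine ⟨max C₁ (A₁ + 27 / 2), lt_max_of_lt_left hC₁0, ?_⟩
  intro q _ χ hprim hq t η ht hη hη1 hsep σ hσ
  have hq1 : (1 : ℝ) < q := by exact_mod_cast hq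
  have hlogq : 0 < Real.log q := Real.log_pos hq1
  have hlog4 : 1 ≤ Real.log (|t| + 4) := by
    rw [Real.le_log_iff_exp_le (by positivity)]
    linarith [Real.exp_one_lt_d9, abs_nonneg t]
  set ℒ : ℝ := Real.log q + Real.log (|t| + 4) with hℒ
  have hℒ1 : 1 ≤ ℒ := by linarith
  have hq2 : (2 : ℝ) ≤ q := by exact_mod_cast hq
  have hlogq2 : Real.log 2 ≤ Real.log q := Real.log_le_log two_pos hq2
  have hlog2 : (1 : ℝ) / 2 < Real.log 2 := by
    have := Real.log_two_gt_d9; linarith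
  by_cases hσ' : -(1 / 2) ≤ σ
  · have hb := (hC₁ q χ hprim hq t η ht hη hη1 hsep σ ⟨hσ', hσ.2⟩).2
    rw [logDeriv_apply] at hb
    refine hb.trans ?_
    rw [div_le_div_iff_of_pos_right hη]
    exact mul_le_mul_of_nonneg_right (le_max_left _ _) (by positivity)
  · push Not at hσ'
    have hb := (hA₁ q χ hprim hq σ t hσ'.le ht).2
    rw [logDeriv_apply] at hb
    refine hb.trans ?_
    -- `A₁ + ℒ + 5(−σ) ≤ A₁ + ℒ + 25/2 ≤ (A₁ + 27/2) ℒ ≤ (A₁ + 27/2) ℒ / η`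
    have h1 : A₁ + Real.log q + Real.log (|t| + 4) + 5 * -σ ≤ (A₁ + 27 / 2) * ℒ := by
      have : 5 * -σ ≤ 25 / 2 := by linarith [hσ.1]
      nlinarith
    calc A₁ + Real.log q + Real.log (|t| + 4) + 5 * -σ ≤ (A₁ + 27 / 2) * ℒ := h1
      _ ≤ max C₁ (A₁ + 27 / 2) * ℒ := mul_le_mul_of_nonneg_right (le_max_right _ _) (by positivity)
      _ ≤ max C₁ (A₁ + 27 / 2) * ℒ / η := by
          rw [le_div_iff₀ hη]
          exact mul_le_of_le_one_right (by positivity) hη1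

/-- **The horizontal sides are small**: at a height `T` with `|T| ≥ 2`, zeros `η`-separated, for
`|Im s| < |T|` and `Re s > −1/2`,
`‖∫_{−5/2}^{3/2} G(σ + iT) dσ‖ ≤ (C_h ℒ(T)/η) · D/(|T| − |Im s|)² · 4`. [folklore] -/
theorem norm_integral_charIntegrand_horizontal_le (h : IsSmoothedEFTest f p p' p'' x₀) {Ch : ℝ}
    (hCh : ∀ (t η : ℝ), 2 ≤ |t| → 0 < η → η ≤ 1 →
      (∀ ρ : ℂ, χ.LFunction ρ = 0 → 0 < ρ.re → ρ.re < 1 → η ≤ |ρ.im - t|) →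
      ∀ σ : ℝ, σ ∈ Icc (-(5 / 2) : ℝ) (3 / 2) →
        ‖deriv χ.LFunction (σ + t * I) / χ.LFunction (σ + t * I)‖ ≤
          Ch * (Real.log q + Real.log (|t| + 4)) / η)
    {s : ℂ} (hσ₁ : -(1 / 2) < s.re) {T η : ℝ} (hT : 2 ≤ |T|) (hsT : |s.im| < |T|) (hη : 0 < η)
    (hη1 : η ≤ 1) (hsep : ∀ ρ : ℂ, χ.LFunction ρ = 0 → 0 < ρ.re → ρ.re < 1 → η ≤ |ρ.im - T|) :
    ‖∫ σ : ℝ in (-(5 / 2) : ℝ)..(3 / 2), charEFIntegrand χ f s (σ + T * I)‖ ≤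
      Ch * (Real.log q + Real.log (|T| + 4)) / η * (SmoothedEF.decayConst p' p'' x₀ / (|T| - |s.im|) ^ 2) * 4 := by
  set D := SmoothedEF.decayConst p' p'' x₀ with hD
  have hD0 : 0 ≤ D := SmoothedEF.decayConst_nonneg h.x₀_nonneg
  have hgap : 0 < |T| - |s.im| := by linarith
  have hbound : ∀ σ ∈ Set.uIoc (-(5 / 2) : ℝ) (3 / 2), ‖charEFIntegrand χ f s (σ + T * I)‖ ≤
      Ch * (Real.log q + Real.log (|T| + 4)) / η * (D / (|T| - |s.im|) ^ 2) := by
    intro σ hσ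
    rw [Set.uIoc_of_le (by norm_num)] at hσ
    have hσ' : σ ∈ Icc (-(5 / 2) : ℝ) (3 / 2) := ⟨hσ.1.le, hσ.2⟩
    set w : ℂ := (σ : ℂ) + T * I with hw
    have hsw_im : (s - w).im = s.im - T := by simp [hw]
    have hsw_re : (s - w).re = s.re - σ := by simp [hw]
    have him : |T| - |s.im| ≤ |(s - w).im| := by
      rw [hsw_im]
      have := abs_sub_abs_le_abs_sub T s.im
      rw [abs_sub_comm] at this
      linarith
    have hnorm : |T| - |s.im| ≤ ‖s - w‖ := him.trans (Complex.abs_im_le_norm _)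
    have hsw : s - w ≠ 0 := norm_pos_iff.1 (hgap.trans_le hnorm)
    have hF : ‖fordLaplace₀ f (s - w)‖ ≤ D / (|T| - |s.im|) ^ 2 := by
      refine (SmoothedEF.norm_fordLaplace₀_le h hsw (by rw [hsw_re]; linarith [hσ.2])).trans ?_
      exact div_le_div_of_nonneg_left hD0 (by positivity) (by gcongr)
    have hL := hCh T η hT hη hη1 hsep σ hσ'
    have hlog : 0 ≤ Ch * (Real.log q + Real.log (|T| + 4)) / η := le_trans (norm_nonneg _) hL
    rw [charEFIntegrand, norm_mul, norm_neg]
    exact mul_le_mul hL hF (norm_nonneg _) hlog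
  refine (intervalIntegral.norm_integral_le_of_norm_le_const hbound).trans_eq ?_
  norm_num

/-! ## The limit `T → ∞`: the exact formula -/

/-- **The smoothed explicit formula for `L(s, χ)`, exact form** (Heath-Brown 1992, Lemma 5.1,
(5.6)–(5.7), with the left line at `Re w = −5/2` and no `O(·)`): for a primitive `χ` mod `q > 1`, an
admissible smoothing `f` and `−1/2 < Re s < 3/2` with `L(s, χ) ≠ 0`,
`K_{f,χ}(s) = Σ Λ(n)χ(n) f(log n) n^{−s}
  = −f(0) (L'/L)(s, χ) − Σ_ρ m(ρ) F₀(s − ρ) − Σ_τ m(τ) F₀(s − τ) + J_χ(s)`,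
`ρ` over the non-trivial zeros (absolutely convergent, `summable_norm_charZeroTerm`), `τ` over the
trivial zeros on `[−5/2, 0]` (`charTrivialZeroFinset`), `J_χ` the left-line integral
(`charEFRemainder`). Here `s` may lie inside the critical strip. [cite: HeathBrown1992PLMS, Lemma 5.1] -/
theorem charFordK_eq_explicit (hprim : χ.IsPrimitive) (hq : 1 < q) (h : IsSmoothedEFTest f p p' p'' x₀)
    {s : ℂ} (hσ₁ : -(1 / 2) < s.re) (hσ₂ : s.re < 3 / 2) (hLs : χ.LFunction s ≠ 0) :
    charFordK χ f s = -(f 0 : ℂ) * (deriv χ.LFunction s / χ.LFunction s) -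
      ∑' ρ : charNontrivialZeros χ,
        (DirichletDisc.zeroOrder χ (ρ : ℂ) : ℂ) * fordLaplace₀ f (s - ρ) -
      ∑ τ ∈ charTrivialZeroFinset (ne_one_of_isPrimitive hprim hq),
        (DirichletDisc.zeroOrder χ τ : ℂ) * fordLaplace₀ f (s - τ) + charEFRemainder χ f s := by
  have hχ : χ ≠ 1 := ne_one_of_isPrimitive hprim hq
  have hsum := (summable_norm_charZeroTerm hprim hq h (by linarith) hLs).of_norm
  set S := ∑' ρ : charNontrivialZeros χ,
    (DirichletDisc.zeroOrder χ (ρ : ℂ) : ℂ) * fordLaplace₀ f (s - ρ) with hS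
  set Striv := ∑ τ ∈ charTrivialZeroFinset hχ,
    (DirichletDisc.zeroOrder χ τ : ℂ) * fordLaplace₀ f (s - τ) with hStriv
  obtain ⟨Ch, hCh0, hCh⟩ := exists_norm_logDeriv_LFunction_horizontal_le
  obtain ⟨c₀, hc₀0, hc₀⟩ := exists_goodHeight
  have hq1 : (1 : ℝ) < q := by exact_mod_cast hq
  have hlogq : 0 < Real.log q := Real.log_pos hq1
  -- good heights `T N ∈ [N, N+1]` with separation `η N = min (c₀/ℒ(T N)) 1`
  have hgh : ∀ N : ℕ, ∃ T : ℝ, (N : ℝ) ≤ T ∧ T ≤ N + 1 ∧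
      ∀ ρ : ℂ, χ.LFunction ρ = 0 → 0 < ρ.re → ρ.re < 1 →
        c₀ / (Real.log q + Real.log (|T| + 4)) ≤ |(|ρ.im|) - T| := by
    intro N
    obtain ⟨T, hT, hsepT⟩ := hc₀ q χ hprim hq N (Nat.cast_nonneg N)
    exact ⟨T, hT.1, hT.2, hsepT⟩
  choose T hTN hTN1 hsep using hgh
  have hTtop : Tendsto T atTop atTop :=
    tendsto_atTop_mono hTN tendsto_natCast_atTop_atTop
  set η : ℕ → ℝ := fun N ↦ min (c₀ / (Real.log q + Real.log (|T N| + 4))) 1 with hη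
  have hT0 : ∀ N, 0 ≤ T N := fun N ↦ (Nat.cast_nonneg N).trans (hTN N)
  have hℒpos : ∀ N, 0 < Real.log q + Real.log (|T N| + 4) := fun N ↦
    add_pos_of_pos_of_nonneg hlogq (Real.log_nonneg (by linarith [abs_nonneg (T N)]))
  have hη0 : ∀ N, 0 < η N := fun N ↦ lt_min (div_pos hc₀0 (hℒpos N)) one_pos
  have hη1 : ∀ N, η N ≤ 1 := fun N ↦ min_le_right _ _
  have hηsep : ∀ N, ∀ ρ : ℂ, χ.LFunction ρ = 0 → 0 < ρ.re → ρ.re < 1 →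
      η N ≤ |ρ.im - T N| ∧ η N ≤ |ρ.im + T N| := fun N ρ h0 h1 h2 ↦
    dist_of_abs_sub_le (hT0 N) ((min_le_left _ _).trans (hsep N ρ h0 h1 h2))
  -- a threshold beyond which `2|Im s| + 2 < N ≤ T N`
  obtain ⟨N₀, hN₀⟩ := exists_nat_gt (2 * |s.im| + 2)
  have hbig : ∀ N : ℕ, max N₀ 2 ≤ N → 2 ≤ N ∧ |s.im| + 1 < T N ∧ (N : ℝ) / 2 ≤ T N - |s.im| := by
    intro N hN
    have hN2 : 2 ≤ N := le_of_max_le_right hN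
    have hNN₀ : (N₀ : ℝ) ≤ N := by exact_mod_cast le_of_max_le_left hN
    have hT := hTN N
    refine ⟨hN2, by linarith [abs_nonneg s.im], by linarith [abs_nonneg s.im]⟩
  -- (1) the truncated zero sums
  have hpart : Tendsto (fun N : ℕ ↦ ∑ ρ ∈ charZeroFinset hχ (T N),
      (DirichletDisc.zeroOrder χ (ρ : ℂ) : ℂ) * fordLaplace₀ f (s - ρ)) atTop (𝓝 S) :=
    (hsum.hasSum.comp (tendsto_charZeroFinset hχ)).comp hTtop
  -- (2) the horizontal sides
  have hhor0 : ∀ sgn : ℝ, (sgn = 1 ∨ sgn = -1) →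
      Tendsto (fun N : ℕ ↦ ∫ σ : ℝ in (-(5 / 2) : ℝ)..(3 / 2),
        charEFIntegrand χ f s (σ + ((sgn * T N : ℝ) : ℂ) * I)) atTop (𝓝 0) := by
    intro sgn hsgn
    set D := SmoothedEF.decayConst p' p'' x₀ with hD
    have hD0 : 0 ≤ D := SmoothedEF.decayConst_nonneg h.x₀_nonneg
    refine squeeze_zero_norm' ?_
      (by simpa using ((ZetaZeroSum.tendsto_log_sq_div.const_mul
        (Ch * (c₀⁻¹ + 1) * (Real.log q + 1) ^ 2 * (D * 4) * 4))))
    filter_upwards [eventually_ge_atTop (max N₀ 2)] with N hN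
    obtain ⟨hN2, hsN, hgapN⟩ := hbig N hN
    have hN2' : (2 : ℝ) ≤ N := by exact_mod_cast hN2
    have hT2 : 2 ≤ T N := by linarith [hTN N]
    have hTabs : |sgn * T N| = T N := by
      rcases hsgn with rfl | rfl <;> simp [abs_of_pos (by linarith : 0 < T N)]
    have hsepN : ∀ ρ : ℂ, χ.LFunction ρ = 0 → 0 < ρ.re → ρ.re < 1 → η N ≤ |ρ.im - sgn * T N| := by
      intro ρ h0 h1 h2
      rcases hsgn with rfl | rfl
      · simpa using (hηsep N ρ h0 h1 h2).1
      · have := (hηsep N ρ h0 h1 h2).2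
        rwa [show ρ.im - -1 * T N = ρ.im + T N by ring]
    have hbd := norm_integral_charIntegrand_horizontal_le h (hCh q χ hprim hq) hσ₁
      (T := sgn * T N) (η := η N) (by rw [hTabs]; exact hT2) (by rw [hTabs]; linarith) (hη0 N) (hη1 N) hsepN
    rw [hTabs] at hbd
    refine hbd.trans ?_
    -- bookkeeping: `ℒ(T)/η ≤ (1/c₀ + 1) ℒ² ≤ (1/c₀ + 1)(log q + 1)² log²(N+7)`, `D/(T-|t|)² ≤ 4D/N`
    set ℓ := Real.log ((N : ℝ) + 7) with hℓ
    have hℓ1 : 1 ≤ ℓ := by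
      rw [hℓ, Real.le_log_iff_exp_le (by positivity)]; linarith [Real.exp_one_lt_d9]
    have habsT : |T N| = T N := abs_of_nonneg (hT0 N)
    have hlog4 : Real.log (T N + 4) ≤ ℓ := Real.log_le_log (by linarith) (by linarith [hTN1 N])
    have hlog41 : 1 ≤ Real.log (T N + 4) := by
      rw [Real.le_log_iff_exp_le (by positivity)]; linarith [Real.exp_one_lt_d9]
    set ℒ := Real.log q + Real.log (T N + 4) with hℒ
    have hℒ1 : 1 ≤ ℒ := by rw [hℒ]; linarith
    have hℒle : ℒ ≤ (Real.log q + 1) * ℓ := by rw [hℒ]; nlinarith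
    have hηN : η N = min (c₀ / ℒ) 1 := by simp only [hη, habsT, hℒ]
    have h1η : 1 / η N ≤ (c₀⁻¹ + 1) * ℒ := by
      rw [hηN]
      rcases le_total (c₀ / ℒ) 1 with hc | hc
      · rw [min_eq_left hc, one_div_div]
        have : 0 ≤ ℒ := by linarith
        nlinarith [show ℒ / c₀ = c₀⁻¹ * ℒ by ring]
      · rw [min_eq_right hc, div_one]
        have : 0 ≤ c₀⁻¹ * ℒ := by positivity
        nlinarith
    have hN0 : (0 : ℝ) < N := by linarith
    have e1 : Ch * ℒ / η N ≤ Ch * (c₀⁻¹ + 1) * (Real.log q + 1) ^ 2 * ℓ ^ 2 := by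
      have e0 : Ch * ℒ / η N = Ch * ℒ * (1 / η N) := by ring
      rw [e0]
      calc Ch * ℒ * (1 / η N) ≤ Ch * ℒ * ((c₀⁻¹ + 1) * ℒ) :=
            mul_le_mul_of_nonneg_left h1η (by positivity)
        _ = Ch * (c₀⁻¹ + 1) * ℒ ^ 2 := by ring
        _ ≤ Ch * (c₀⁻¹ + 1) * ((Real.log q + 1) * ℓ) ^ 2 := by
            gcongr
        _ = Ch * (c₀⁻¹ + 1) * (Real.log q + 1) ^ 2 * ℓ ^ 2 := by ring
    have hsq : ((N : ℝ) / 2) ^ 2 ≤ (T N - |s.im|) ^ 2 := pow_le_pow_left₀ (by positivity) hgapN 2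
    have hsq' : (N : ℝ) / 4 ≤ (T N - |s.im|) ^ 2 := by nlinarith
    have e2 : D / (T N - |s.im|) ^ 2 ≤ D * 4 / N :=
      (div_le_div_of_nonneg_left hD0 (by positivity) hsq').trans_eq (by rw [div_div_eq_mul_div])
    calc Ch * ℒ / η N * (D / (T N - |s.im|) ^ 2) * 4
        ≤ Ch * (c₀⁻¹ + 1) * (Real.log q + 1) ^ 2 * ℓ ^ 2 * (D * 4 / N) * 4 :=
          mul_le_mul_of_nonneg_right (mul_le_mul e1 e2 (by positivity) (by positivity)) (by norm_num)
      _ = Ch * (c₀⁻¹ + 1) * (Real.log q + 1) ^ 2 * (D * 4) * 4 * (ℓ ^ 2 / N) := by ring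
  -- (3) the vertical sides
  obtain ⟨hIright, hvalright⟩ := integral_charIntegrand_right (χ := χ) h hσ₂
  have hright : Tendsto (fun N : ℕ ↦ ∫ y : ℝ in (-T N)..T N,
      charEFIntegrand χ f s (((3 / 2 : ℝ) : ℂ) + y * I)) atTop (𝓝 (2 * π * charFordK χ f s)) := by
    have h3 := intervalIntegral_tendsto_integral hIright (tendsto_neg_atTop_atBot.comp hTtop) hTtop
    rwa [hvalright] at h3
  have hleft : Tendsto (fun N : ℕ ↦ ∫ y : ℝ in (-T N)..T N,
      charEFIntegrand χ f s (((-(5 / 2) : ℝ) : ℂ) + y * I)) atTop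
      (𝓝 (2 * π * charEFRemainder χ f s)) := by
    have h3 := intervalIntegral_tendsto_integral (integrable_charIntegrand_left hprim hq h hσ₁)
      (tendsto_neg_atTop_atBot.comp hTtop) hTtop
    have hval : ∫ y : ℝ, charEFIntegrand χ f s (((-(5 / 2) : ℝ) : ℂ) + y * I) =
        2 * π * charEFRemainder χ f s := by
      have hπ : (2 * π : ℂ) ≠ 0 := by simp [Real.pi_ne_zero]
      rw [charEFRemainder, ← mul_assoc, mul_one_div_cancel hπ, one_mul]
    rwa [hval] at h3
  -- (4) the boundary integral along `T N` and its two limits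
  have hlim1 : Tendsto (fun N : ℕ ↦
      Literature.Analysis.Complex.rectBoundaryIntegral (charEFIntegrand χ f s) (-(5 / 2)) (3 / 2)
        (-T N) (T N)) atTop
      (𝓝 (0 - 0 + I * (2 * π * charFordK χ f s) - I * (2 * π * charEFRemainder χ f s))) := by
    have hb := hhor0 (-1) (Or.inr rfl)
    have ht := hhor0 1 (Or.inl rfl)
    simp only [neg_mul, one_mul] at hb ht
    have := ((hb.sub ht).add (hright.const_mul I)).sub (hleft.const_mul I)
    refine this.congr fun N ↦ ?_
    simp only [Literature.Analysis.Complex.rectBoundaryIntegral]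
  have hgoodN : ∀ N, max N₀ 2 ≤ N → ∀ ρ : ℂ, χ.LFunction ρ = 0 → ρ.im ≠ 0 →
      ρ.im ≠ T N ∧ ρ.im ≠ -T N := by
    intro N hN ρ h0 him
    obtain ⟨h1, h2⟩ := re_mem_Ioo_of_LFunction_eq_zero_of_im_ne_zero hprim hχ h0 him
    obtain ⟨ha, hb⟩ := hηsep N ρ h0 h1 h2
    have hη0N := hη0 N
    refine ⟨fun he ↦ ?_, fun he ↦ ?_⟩
    · rw [he, sub_self, abs_zero] at ha; linarith
    · rw [he, neg_add_cancel, abs_zero] at hb; linarith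
  have hid : ∀ᶠ N : ℕ in atTop,
      2 * π * I * (-(f 0 : ℂ) * (deriv χ.LFunction s / χ.LFunction s) -
        (∑ ρ ∈ charZeroFinset hχ (T N), (DirichletDisc.zeroOrder χ (ρ : ℂ) : ℂ) * fordLaplace₀ f (s - ρ)
          + Striv)) =
        Literature.Analysis.Complex.rectBoundaryIntegral (charEFIntegrand χ f s) (-(5 / 2)) (3 / 2)
          (-T N) (T N) := by
    filter_upwards [eventually_ge_atTop (max N₀ 2)] with N hN
    obtain ⟨hN2, hsN, -⟩ := hbig N hN
    rw [charEF_contour_identity hprim hq h.cont h.x₀_nonneg h.eq_zero (by linarith) hσ₂ hLs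
      (T := T N) (by linarith) (hgoodN N hN), rect_zeros_eq_union hprim hq (hT0 N),
      Finset.sum_union (disjoint_box_trivial hχ (T N)), ← sum_charZeroFinset_eq hχ (T N)]
  have hlim2 : Tendsto (fun N : ℕ ↦
      2 * π * I * (-(f 0 : ℂ) * (deriv χ.LFunction s / χ.LFunction s) -
        (∑ ρ ∈ charZeroFinset hχ (T N), (DirichletDisc.zeroOrder χ (ρ : ℂ) : ℂ) * fordLaplace₀ f (s - ρ)
          + Striv)))
      atTop (𝓝 (2 * π * I * (-(f 0 : ℂ) * (deriv χ.LFunction s / χ.LFunction s) - (S + Striv)))) :=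
    (tendsto_const_nhds.sub (hpart.add tendsto_const_nhds)).const_mul _
  have heq := tendsto_nhds_unique hlim2 (hlim1.congr' (hid.mono fun N h ↦ h.symm))
  have hπ : (2 * π * I : ℂ) ≠ 0 := by simp [Real.pi_ne_zero]
  have key : 2 * π * I * (charFordK χ f s - charEFRemainder χ f s) =
      2 * π * I * (-(f 0 : ℂ) * (deriv χ.LFunction s / χ.LFunction s) - (S + Striv)) := by
    rw [heq]; ring
  have := mul_left_cancel₀ hπ key
  linear_combination this

/-! ## Bounding the remainder and the trivial-zero terms -/

/-- **The left-line integral is `O(B ℒ)`**: there is an absolute `C > 0` such that for every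
primitive `χ` mod `q > 1`, every `f`, every `s` with `Re s > −1/2` and every `B ≥ 0` with
`‖F₀(s − w)‖ ≤ B/((Re s + 5/2)² + (Im s − Im w)²)` along `Re w = −5/2`:
`‖J_χ(s)‖ ≤ C · B · (log q + log(1 + |Im s|))`
(`|L'/L(−5/2 + iy, χ)| ≤ A + log q + 2 log(1 + |y|)` integrated against the Poisson-type kernel).
[cite: HeathBrown1992PLMS, Lemma 5.1 (proof, bound for the line Re w = -1/2)] -/
theorem exists_norm_charEFRemainder_le :
    ∃ C : ℝ, 0 < C ∧ ∀ (q : ℕ) [NeZero q] (χ : DirichletCharacter ℂ q), χ.IsPrimitive → 1 < q →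
      ∀ (f : ℝ → ℝ) (s : ℂ) (B : ℝ), 0 ≤ B → -(1 / 2) < s.re →
        (∀ y : ℝ, ‖fordLaplace₀ f (s - ((((-(5 / 2) : ℝ)) : ℂ) + y * I))‖ ≤
          B / ((s.re + 5 / 2) ^ 2 + (s.im - y) ^ 2)) →
        ‖charEFRemainder χ f s‖ ≤ C * B * (Real.log q + Real.log (1 + |s.im|)) := by
  obtain ⟨A₀, hA₀0, hA₀⟩ := exists_norm_logDeriv_LFunction_leftLine_le
  -- enlarge the constant to `A ≥ 1`
  set A : ℝ := max A₀ 1 with hAdef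
  have hA1 : 1 ≤ A := le_max_right _ _
  have hA0 : 0 < A := one_pos.trans_le hA1
  have hA : ∀ (q : ℕ) [NeZero q] (χ : DirichletCharacter ℂ q), χ.IsPrimitive → 1 < q →
      ∀ y : ℝ, ‖deriv χ.LFunction ((((-(5 / 2) : ℝ)) : ℂ) + y * I) /
          χ.LFunction ((((-(5 / 2) : ℝ)) : ℂ) + y * I)‖ ≤ A + Real.log q + 2 * Real.log (1 + |y|) :=
    fun q _ χ hprim hq y ↦ (hA₀ q χ hprim hq y).2.trans (by linarith [le_max_left A₀ 1])
  -- the absolute constant `K = ∫ (1 + 2 log(1+|u|))/(1/4 + u²) du`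
  set K : ℝ := ∫ u : ℝ, (1 + 2 * Real.log (1 + |u|)) / (1 / 4 + u ^ 2) with hK
  have hKint := PsiOneExplicit.integrable_left_majorant (A := 1) zero_le_one
  have hK0 : 0 ≤ K := integral_nonneg fun u ↦ by
    have : 0 ≤ Real.log (1 + |u|) := Real.log_nonneg (by linarith [abs_nonneg u])
    positivity
  have hlog2 : (0 : ℝ) < Real.log 2 := Real.log_pos one_lt_two
  refine ⟨(1 / (2 * π)) * K * (A / Real.log 2 + 3) + 1, by positivity, ?_⟩
  intro q _ χ hprim hq f s B hB hσ hF
  have hq2 : (2 : ℝ) ≤ q := by exact_mod_cast hq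
  have hlogq : Real.log 2 ≤ Real.log q := Real.log_le_log two_pos hq2
  have hlogq0 : 0 ≤ Real.log q := hlog2.le.trans hlogq
  set t := s.im with ht
  set a : ℝ := s.re + 5 / 2 with ha
  have ha2 : 2 ≤ a := by rw [ha]; linarith
  have hlt0 : 0 ≤ Real.log (1 + |t|) := Real.log_nonneg (by linarith [abs_nonneg t])
  have hL0 : 0 ≤ Real.log q + Real.log (1 + |t|) := add_nonneg hlogq0 hlt0
  set A' : ℝ := A + Real.log q + 2 * Real.log (1 + |t|) with hA'
  have hA'1 : 1 ≤ A' := by rw [hA']; linarith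
  -- pointwise majorant on the line
  set g : ℝ → ℝ := fun y ↦ B * (A' * ((1 + 2 * Real.log (1 + |y - t|)) / (1 / 4 + (y - t) ^ 2))) with hg
  have hgint : Integrable g := by
    have h1 := (hKint.comp_sub_right t).const_mul (B * A')
    refine h1.congr (ae_of_all _ fun y ↦ ?_)
    simp only [hg]
    ring
  have hptw : ∀ y : ℝ, ‖charEFIntegrand χ f s ((((-(5 / 2) : ℝ)) : ℂ) + y * I)‖ ≤ g y := by
    intro y
    have hb := hA q χ hprim hq y
    rw [charEFIntegrand, norm_mul, norm_neg]
    have hFy := hF y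
    have hlogy : Real.log (1 + |y|) ≤ Real.log (1 + |t|) + Real.log (1 + |y - t|) :=
      SmoothedEF.log_one_add_abs_le_add y t
    have hly0 : 0 ≤ Real.log (1 + |y - t|) := Real.log_nonneg (by linarith [abs_nonneg (y - t)])
    have hlogy0 : 0 ≤ Real.log (1 + |y|) := Real.log_nonneg (by linarith [abs_nonneg y])
    have hnum : A + Real.log q + 2 * Real.log (1 + |y|) ≤ A' * (1 + 2 * Real.log (1 + |y - t|)) := by
      rw [hA']
      nlinarith
    have hden : (1 / 4 + (y - t) ^ 2) ≤ a ^ 2 + (t - y) ^ 2 := by nlinarith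
    have hfrac : B / (a ^ 2 + (t - y) ^ 2) ≤ B / (1 / 4 + (y - t) ^ 2) :=
      div_le_div_of_nonneg_left hB (by positivity) hden
    have hnum0 : 0 ≤ A + Real.log q + 2 * Real.log (1 + |y|) := by positivity
    have hA'0 : 0 ≤ A' * (1 + 2 * Real.log (1 + |y - t|)) := mul_nonneg (by linarith) (by linarith)
    calc ‖deriv χ.LFunction ((((-(5 / 2) : ℝ)) : ℂ) + y * I) / χ.LFunction ((((-(5 / 2) : ℝ)) : ℂ) + y * I)‖ *
          ‖fordLaplace₀ f (s - ((((-(5 / 2) : ℝ)) : ℂ) + y * I))‖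
        ≤ (A + Real.log q + 2 * Real.log (1 + |y|)) * (B / (a ^ 2 + (t - y) ^ 2)) :=
          mul_le_mul hb (by rw [ha, ht]; exact hFy) (norm_nonneg _) hnum0
      _ ≤ (A' * (1 + 2 * Real.log (1 + |y - t|))) * (B / (1 / 4 + (y - t) ^ 2)) :=
          mul_le_mul hnum hfrac (by positivity) hA'0
      _ = g y := by rw [hg]; ring
  have hI : ‖∫ y : ℝ, charEFIntegrand χ f s ((((-(5 / 2) : ℝ)) : ℂ) + y * I)‖ ≤ B * (A' * K) := by
    refine (norm_integral_le_of_norm_le hgint (ae_of_all _ hptw)).trans_eq ?_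
    rw [hg, integral_const_mul, integral_const_mul]
    congr 2
    rw [hK]
    exact integral_sub_right_eq_self (fun u : ℝ ↦ (1 + 2 * Real.log (1 + |u|)) / (1 / 4 + u ^ 2)) t
  -- assemble
  have hA'le : A' ≤ (A / Real.log 2 + 3) * (Real.log q + Real.log (1 + |t|)) := by
    rw [hA']
    have h1 : A ≤ A / Real.log 2 * Real.log q := by
      rw [div_mul_eq_mul_div, le_div_iff₀ hlog2]
      exact mul_le_mul_of_nonneg_left hlogq hA0.le
    nlinarith [div_nonneg hA0.le hlog2.le]
  rw [charEFRemainder, norm_mul]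
  have hπ : ‖(1 / (2 * π) : ℂ)‖ = 1 / (2 * π) := by
    rw [show (1 / (2 * π) : ℂ) = ((1 / (2 * π) : ℝ) : ℂ) by push_cast; ring, Complex.norm_real,
      Real.norm_eq_abs, abs_of_pos (by positivity)]
  rw [hπ]
  calc 1 / (2 * π) * ‖∫ y : ℝ, charEFIntegrand χ f s ((((-(5 / 2) : ℝ)) : ℂ) + y * I)‖
      ≤ 1 / (2 * π) * (B * (A' * K)) := mul_le_mul_of_nonneg_left hI (by positivity)
    _ = (1 / (2 * π) * K) * B * A' := by ring
    _ ≤ (1 / (2 * π) * K) * B * ((A / Real.log 2 + 3) * (Real.log q + Real.log (1 + |t|))) :=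
        mul_le_mul_of_nonneg_left hA'le (by positivity)
    _ = (1 / (2 * π) * K * (A / Real.log 2 + 3)) * B * (Real.log q + Real.log (1 + |t|)) := by ring
    _ ≤ ((1 / (2 * π)) * K * (A / Real.log 2 + 3) + 1) * B * (Real.log q + Real.log (1 + |t|)) :=
        mul_le_mul_of_nonneg_right (mul_le_mul_of_nonneg_right (by linarith) hB) hL0

/-- **The trivial zeros on `[−5/2, 0]`, even case**: `{0, −2}` (primitive `χ` mod `q > 1`).
[cite: MontgomeryVaughan2007, Corollary 10.8] -/
theorem charTrivialZeroFinset_of_even (hprim : χ.IsPrimitive) (hq : 1 < q) (heven : χ.Even) :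
    charTrivialZeroFinset (ne_one_of_isPrimitive hprim hq) = {0, -2} := by
  have hχ : χ ≠ 1 := ne_one_of_isPrimitive hprim hq
  ext τ
  rw [mem_charTrivialZeroFinset, Finset.mem_insert, Finset.mem_singleton]
  constructor
  · rintro ⟨h0, h1, h2, h3⟩
    obtain ⟨n, hn⟩ := (LFunction_eq_zero_iff_of_even hprim hχ heven h2).1 h0
    have hre : τ.re = -(2 * (n : ℝ)) := by rw [hn]; simp
    have hn1 : n ≤ 1 := by
      by_contra hc
      push Not at hc
      have : (2 : ℝ) ≤ n := by exact_mod_cast hc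
      linarith
    interval_cases n
    · left; rw [hn]; simp
    · right; rw [hn]; norm_num
  · rintro (rfl | rfl)
    · exact ⟨LFunction_zero_eq_zero_of_even hprim hχ heven, by norm_num, le_rfl, rfl⟩
    · refine ⟨(LFunction_eq_zero_iff_of_even hprim hχ heven (by norm_num)).2 ⟨1, by norm_num⟩,
        by norm_num, by norm_num, by norm_num⟩

/-- **The trivial zeros on `[−5/2, 0]`, odd case**: `{−1}`. [cite: MontgomeryVaughan2007, Corollary 10.8] -/
theorem charTrivialZeroFinset_of_odd (hprim : χ.IsPrimitive) (hq : 1 < q) (hodd : χ.Odd) :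
    charTrivialZeroFinset (ne_one_of_isPrimitive hprim hq) = {-1} := by
  have hχ : χ ≠ 1 := ne_one_of_isPrimitive hprim hq
  ext τ
  rw [mem_charTrivialZeroFinset, Finset.mem_singleton]
  constructor
  · rintro ⟨h0, h1, h2, h3⟩
    obtain ⟨n, hn⟩ := (LFunction_eq_zero_iff_of_odd hprim hχ hodd h2).1 h0
    have hre : τ.re + 1 = -(2 * (n : ℝ)) := by
      have := congrArg Complex.re hn; simpa using this
    have hn0 : n = 0 := by
      by_contra hc
      have : (1 : ℝ) ≤ n := by exact_mod_cast Nat.one_le_iff_ne_zero.2 hc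
      linarith
    subst hn0
    have hτ : τ = -1 := by
      have h' : τ + 1 = 0 := by simpa using hn
      linear_combination h'
    exact hτ
  · rintro rfl
    refine ⟨(LFunction_eq_zero_iff_of_odd hprim hχ hodd (by norm_num)).2 ⟨0, by norm_num⟩,
      by norm_num, by norm_num, by norm_num⟩

/-- On the trivial zeros the multiplicity is `1`. [cite: MontgomeryVaughan2007, Theorem 10.17] -/
theorem zeroOrder_eq_one_of_mem_charTrivialZeroFinset (hprim : χ.IsPrimitive) (hq : 1 < q) {τ : ℂ}
    (hτ : τ ∈ charTrivialZeroFinset (ne_one_of_isPrimitive hprim hq)) :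
    DirichletDisc.zeroOrder χ τ = 1 := by
  have hχ : χ ≠ 1 := ne_one_of_isPrimitive hprim hq
  rw [mem_charTrivialZeroFinset] at hτ
  exact zeroOrder_trivialZero hprim hχ ((LFunction_eq_zero_iff_gammaFactor hprim hχ hτ.2.2.1).1 hτ.1)

/-- **The trivial-zero terms are at most `2M`**: if `‖F₀(s − τ)‖ ≤ M` for `τ ∈ {0, −1, −2}` then
`‖Σ_τ m(τ) F₀(s − τ)‖ ≤ 2M`. [folklore] -/
theorem norm_sum_trivial_le (hprim : χ.IsPrimitive) (hq : 1 < q) {s : ℂ} {M : ℝ} (hM : 0 ≤ M)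
    (h0 : ‖fordLaplace₀ f s‖ ≤ M) (h1 : ‖fordLaplace₀ f (s + 1)‖ ≤ M)
    (h2 : ‖fordLaplace₀ f (s + 2)‖ ≤ M) :
    ‖∑ τ ∈ charTrivialZeroFinset (ne_one_of_isPrimitive hprim hq),
        (DirichletDisc.zeroOrder χ τ : ℂ) * fordLaplace₀ f (s - τ)‖ ≤ 2 * M := by
  have hχ : χ ≠ 1 := ne_one_of_isPrimitive hprim hq
  have hm : ∀ τ ∈ charTrivialZeroFinset hχ, (DirichletDisc.zeroOrder χ τ : ℂ) = 1 := fun τ hτ ↦ by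
    rw [zeroOrder_eq_one_of_mem_charTrivialZeroFinset hprim hq hτ, Nat.cast_one]
  rw [Finset.sum_congr rfl fun τ hτ ↦ by rw [hm τ hτ, one_mul]]
  rcases χ.even_or_odd with heven | hodd
  · rw [charTrivialZeroFinset_of_even hprim hq heven, Finset.sum_insert (by norm_num),
      Finset.sum_singleton, sub_zero, sub_neg_eq_add]
    exact (norm_add_le _ _).trans (by linarith)
  · rw [charTrivialZeroFinset_of_odd hprim hq hodd, Finset.sum_singleton, sub_neg_eq_add]
    linarith

end ExplicitPsiChar

end Literature.NumberTheory.LFunctions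

end
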